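import Literature.NumberTheory.Rogawski1990.ArchChartOrbGTensorOverPlacesMixed   -- ★ (F2) p852083 (F0P2-p02 (g21)): `chartOrbG_eq_prod_quotient_mul_integral_of_tensor` (mixed tensor, the `p`-places MAY meet `S′`)
import Literature.NumberTheory.Rogawski1990.ArchChartOrbGOrbitCongr           -- ★ (c1) p852248 (F0P3b-p01 (g19)): `orbFamGExt_eq_zero_of_forall_conj_of_mem_regG`; brings ★ `orbFamGExt_of_mem_regG_of_admissible`
import Literature.NumberTheory.Rogawski1990.ArchBouazizClassMapG             -- ★ F0 p851983: `bzClassG`, `bzClassMapG`, `bzClassG_conj`, `bzClassG_gprimeTorus`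
import Literature.NumberTheory.Automorphic.ArchInnerFormChartOrbLocal        -- ★ `chartOrbGLoc`, `chartOrbGLoc_eq_of_isHaarMeasure`
import HarnessLib

/-!
# EP ASSEMBLY — THE JUNK-LABEL CLAUSE: on a label `S` meeting the definite block at `w₀`, the `β`-member of the per-ball tensor VANISHES at every partner point of a
# `G`-regular point (N8-INNER ROAD B, brick (12′) E3a slice (s2); Rogawski 1990 §4.1, §8.2–8.3; Shelstad 1979 §4)

Topic `NumberTheory/Rogawski1990`; namespaces `Literature.NumberTheory.Automorphic.UnitaryGroup` (§0: two corollaries of ★ (F2) in ITS context) and `Literature.NumberTheory.Rogawski1990`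
(§1: the junk-label head in the E3a pen's currency).  THEOREMS ONLY (no `def`, no instance, no notation, no axiom, no named fact, no `sorry`).  Cell `pub/hodgecm-mathlib`, crux H413
(`stmt-HodgeConjecture-24833`), F0∕P3c road «N8-INNER» ROAD B, brick (12′) «EP ASSEMBLY», E3a slice (s2) «JUNK-LABEL CLAUSE» (carved by LH3-p04 (g7) 2026-09-02T17:10:40Z, token line by the
E3a pen LH7-p04 (g8) 17:29:12Z; docking letter = ★ (L1) p852251 `ballIdentity_of_readings`'s binder `hjunk`).  Seat LH3-p03 (g8).  Count-neutral.

THE MATHEMATICS.  Frame `β` (E3a: `β₀ = (2⁻¹, 1, −2⁻¹)`), `G_∞ = U(diag β)(L⁺ ⊗ ℝ) ≃ Π_w U(β)_w` in PRODUCT-MEASURE form (`ν′ = e⁻¹⁎ ⊗_w ν′_w`, `e := archPiEquivCM`), an admissible label `S`, the block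
`p` of the `α`-DEFINITE places (`D`), a `G`-regular point `c ∈ RegG S`.  The per-ball test function of the (12′) assembly has the ★ §2(7) p852249 shape
`f(k) = (Π_{w : p} mcl_w(cl_w k) · f_w(k_w)) · G(cl_D k, k_I)` (`hf`; `cl_w k := bzClassG L β k w`, `k_w := e k w`), where at the place `w₀ ∈ D` the class multiplier `mcl_{w₀}` is supported
in the `ε`-ball round the centre `b` (`hmcl`) and `f_{w₀}` is an E1 generator whose SPLIT CLAUSE reads, on the label `S ∋ w₀`: `c′ w₀ 0 ≠ 0 → dist (cl^S_{w₀}(c′)) b < ε →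
chartOrbGLoc L β w₀ S ν′_{w₀} f_{w₀} (c′ w₀) = 0` (`hsplit`, ★ E1 `EPGeneratorAt`'s fourth conjunct).  CLAIM (§1 **`orbFamGExt_slotPerm_eq_zero_of_tensor_of_split`**): if `S` MEETS the
block at `w₀` (`w₀ ∈ S`, `p w₀`), then `orbFamGExt L β ν′ f S (ρ·c) = 0` for every partner relabelling `ρ ∈ partnerPerms S`.  PROOF.  `c′ := ρ·c` is again `G`-regular (★
`slotPerm_mem_regG_iff`), so `orbFamGExt … c′ = R_S(c′) · chartOrbG ν′ S f c′` (★ `orbFamGExt_of_mem_regG_of_admissible`) and `c′ w₀ 0 ≠ 0`.  DICHOTOMY on the frozen weight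
`mcl_{w₀}(cl^S_{w₀}(c′))`: (A) if it is `0`, `f` VANISHES on the conjugacy class of the chart point `γ(S, c′)` — the classes are frozen there at `cl^S(c′)` (★ `bzClassG_conj`, ★
`bzClassG_gprimeTorus`) — so ★ (c1) `orbFamGExt_eq_zero_of_forall_conj_of_mem_regG` gives `0`; (B) otherwise `dist (cl^S_{w₀}(c′)) b < ε` (`hmcl`), the split clause kills the ONE-PLACE
reading `chartOrbGLoc … f_{w₀} (c′ w₀) = 0`, and ★ (F2) `chartOrbG_eq_prod_quotient_mul_integral_of_tensor` — applied to `f` itself with one-place generators `f_w` and the factor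
`u(k) := (Π_w mcl_w(cl_w k)) · G(cl_D k, k_I)` (invariant under conjugating the `p`-coordinates: classes are conjugation invariant place by place, Mathlib `Matrix.charpoly_units_conj`) —
writes `chartOrbG ν′ S f c′` as a PRODUCT over the `p`-places of the local quotient readings times an `I`-side reading; the `w₀`-factor is `chartOrbGLoc … f_{w₀} (c′ w₀)` (§0
`boxMass_mul_integral_descConj_eq_chartOrbGLoc`: ★ (F2)'s abstract quotient σ-algebra is the Borel one, ★ `chartOrbGLoc_eq_of_isHaarMeasure`) `= 0`, so the product vanishes (§0
`chartOrbG_eq_zero_of_tensor_of_chartOrbGLoc_eq_zero` = the (12′)∕(T2) sentence of ★ (F2)'s docblock: ONE vanishing one-place reading among the `p`-places kills `chartOrbG` of the tensor).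
The `α`-side of the junk label is `0` by ★ `orbFamGExt_of_not_admissible` (in ★ (L1)); this file is the `β`-side.
HONEST LABEL: HC_CM is proved only modulo the 7 printed citations (2 remaining: hLiu418 = `stmt-HodgeConjecture-24832`, h413 = `stmt-HodgeConjecture-24833`) until rung 0 closes; count-neutral —
a reading of ★ files, pays nothing alone.

## References
* [Rogawski1990] J. D. Rogawski, *Automorphic Representations of Unitary Groups in Three Variables*, Ann. of Math. Stud. 123 (1990), §4.1 (4.1.1) p. 39 (`Φ^st` as the sum over the classes in a
  stable class), §8.2 p. 122, §8.3 p. 124 (orbital integrals place by place), §3.6 p. 28 (classes and characteristic polynomials).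
* [Shelstad1979] D. Shelstad, *Characters and inner forms of a quasi-split group over ℝ*, Compositio Math. 39 (1979), §4 p. 22 (`Ψ^T_f`), Lemma 4.2 p. 23 (partner classes).
* [Folland1995] G. B. Folland, *A Course in Abstract Harmonic Analysis* (1995), §2.2; §2.6 Thm. 2.49, (2.52) (quotient integral formula).
* [Bouaziz1994IntegralesOrbitales] A. Bouaziz, *Intégrales orbitales sur les groupes de Lie réductifs*, Ann. Sci. ÉNS (4) 27 (1994), §2.3 p. 578 (class functions), §6.2 p. 591.
-/

set_option autoImplicit false

noncomputable section

open MeasureTheory MeasureTheory.Measure NumberField NumberField.InfinitePlace Matrix Complex Topology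
open Literature.MeasureTheory.Group Literature.NumberTheory.Rogawski1990 Literature.NumberTheory.Automorphic Literature.NumberTheory.Automorphic.UnitaryGroup
  Literature.NumberTheory.Automorphic.ArchCartan
open scoped MatrixGroups Matrix Classical ENNReal NNReal

namespace Literature.NumberTheory.Automorphic.UnitaryGroup

/-! ## §0 Two corollaries of ★ (F2), in its context: the abstract local quotient reading IS `chartOrbGLoc`; ONE vanishing `p`-place reading kills `chartOrbG` of the tensor -/

section TensorVanish

variable (L : Type) [Field L] [NumberField L] [IsCMField L] (β : Fin 3 → L) (S' : Finset {w : InfinitePlace L // IsComplex w})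
  [∀ w : {w : InfinitePlace L // IsComplex w}, MeasurableSpace ↥(archLocal L 3 (Matrix.diagonal β) w)]
  [∀ w : {w : InfinitePlace L // IsComplex w}, BorelSpace ↥(archLocal L 3 (Matrix.diagonal β) w)]
  [∀ w : {w : InfinitePlace L // IsComplex w}, LocallyCompactSpace ↥(archLocal L 3 (Matrix.diagonal β) w)]
  [∀ w : {w : InfinitePlace L // IsComplex w}, SecondCountableTopology ↥(archLocal L 3 (Matrix.diagonal β) w)]
  [MeasurableSpace ↥(arch (↥(maximalRealSubfield L)) L (IsCMField.complexConj L) 3 (Matrix.diagonal β))]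
  [BorelSpace ↥(arch (↥(maximalRealSubfield L)) L (IsCMField.complexConj L) 3 (Matrix.diagonal β))]
  [∀ w : {w : InfinitePlace L // IsComplex w}, MeasurableSpace (↥(archLocal L 3 (Matrix.diagonal β) w) ⧸ chartTorusGLoc L β w S')]
  [∀ w : {w : InfinitePlace L // IsComplex w}, BorelSpace (↥(archLocal L 3 (Matrix.diagonal β) w) ⧸ chartTorusGLoc L β w S')]
  (ν'w : ∀ w : {w : InfinitePlace L // IsComplex w}, Measure ↥(archLocal L 3 (Matrix.diagonal β) w)) [∀ w, (ν'w w).IsHaarMeasure] [∀ w, (ν'w w).IsMulRightInvariant]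
  (ν' : Measure ↥(arch (↥(maximalRealSubfield L)) L (IsCMField.complexConj L) 3 (Matrix.diagonal β))) [ν'.IsHaarMeasure] [ν'.IsMulRightInvariant]
  (hν : ν' = (Measure.pi ν'w).map (archPiEquivCM 3 L (Matrix.diagonal β)).symm)
  (t : ∀ w : {w : InfinitePlace L // IsComplex w}, Measure ↥(chartTorusGLoc L β w S')) [∀ w, (t w).IsHaarMeasure] [∀ w, (t w).IsInvInvariant]
  (p : {w : InfinitePlace L // IsComplex w} → Prop) [DecidablePred p]
  [Fintype {w : {w : InfinitePlace L // IsComplex w} // p w}] [Fintype {w : {w : InfinitePlace L // IsComplex w} // ¬ p w}]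

omit [MeasurableSpace ↥(arch (↥(maximalRealSubfield L)) L (IsCMField.complexConj L) 3 (Matrix.diagonal β))]
  [BorelSpace ↥(arch (↥(maximalRealSubfield L)) L (IsCMField.complexConj L) 3 (Matrix.diagonal β))] in
/-- **★ (F2)'s `p`-FACTOR IS `chartOrbGLoc`** («the rewrite is the consumer's»): for ANY place `w`, one-place function `g` and coordinate `cw`, the local quotient reading of ★ (F2)∕(J-iso)^T in
the section's ABSTRACT Borel quotient σ-algebra and generic torus Haar measure `t_w`, `t_w(B′_w) · ∫_{U_w ⧸ T′_w} g(ẏ γ_w(cw) ẏ⁻¹) d(ν′_w ∕ t_w)(ẏ)`, equals `chartOrbGLoc L β w S′ ν′_w g cw`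
(whose σ-algebra and torus measure are baked in) — the Borel σ-algebra is unique (`BorelSpace.measurable_eq`) and ★ `chartOrbGLoc_eq_of_isHaarMeasure` is Haar-free in `t_w`.
[cite: Rogawski1990, §8.2 p. 122; §8.3 p. 124] [cite: Folland1995, §2.6 Thm. 2.49, (2.52)] -/
theorem boxMass_mul_integral_descConj_eq_chartOrbGLoc (w : {w : InfinitePlace L // IsComplex w})
    (g : ↥(archLocal L 3 (Matrix.diagonal β) w) → ℂ) (cw : Fin 3 → ℝ) :
    ((t w (chartBoxImgGLoc L β w S')).toReal : ℂ) *
        ∫ y : ↥(archLocal L 3 (Matrix.diagonal β) w) ⧸ chartTorusGLoc L β w S',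
          g (descConj (gprimeBlockAt L β w S' cw) (chartTorusGLoc L β w S') (forall_mem_chartTorusGLoc_comm L β w S' cw) id y)
          ∂(quotientMeasure (chartTorusGLoc L β w S') (t w) (isClosed_chartTorusGLoc L β w S') (ν'w w)) =
      chartOrbGLoc L β w S' (ν'w w) g cw := by
  -- generalise the section's quotient σ-algebra at the place `w`, then identify it with the Borel one
  suffices key : ∀ (m : MeasurableSpace (↥(archLocal L 3 (Matrix.diagonal β) w) ⧸ chartTorusGLoc L β w S'))
      (hB : @BorelSpace (↥(archLocal L 3 (Matrix.diagonal β) w) ⧸ chartTorusGLoc L β w S') _ m),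
      (letI : MeasurableSpace (↥(archLocal L 3 (Matrix.diagonal β) w) ⧸ chartTorusGLoc L β w S') := m
       ((t w (chartBoxImgGLoc L β w S')).toReal : ℂ) *
        ∫ y : ↥(archLocal L 3 (Matrix.diagonal β) w) ⧸ chartTorusGLoc L β w S',
          g (descConj (gprimeBlockAt L β w S' cw) (chartTorusGLoc L β w S') (forall_mem_chartTorusGLoc_comm L β w S' cw) id y)
          ∂(quotientMeasure (chartTorusGLoc L β w S') (t w) (isClosed_chartTorusGLoc L β w S') (ν'w w))) =
      chartOrbGLoc L β w S' (ν'w w) g cw from key _ inferInstance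
  intro m hB
  obtain rfl : m = borel _ := @BorelSpace.measurable_eq _ _ m hB
  rw [chartOrbGLoc_eq_of_isHaarMeasure L β w S' (ν'w w) (t w) g cw]
  -- the integrands `g (ẏ γ ẏ⁻¹)` and `descConj … g ẏ` agree coset by coset (★ `descConj_mk`, definitional)
  congr 1
  refine integral_congr_ae (Filter.Eventually.of_forall fun y => ?_)
  induction y using QuotientGroup.induction_on with
  | H x => rfl

include hν t in
/-- **ONE VANISHING ONE-PLACE READING AMONG THE `p`-PLACES KILLS `chartOrbG` OF THE TENSOR** (the (12′)∕(T2) sentence of ★ (F2)'s docblock, as a theorem): in ★ (F2)'s binders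
(`p` ANY decidable predicate — the `p`-places MAY meet `S′`; `c ∈ RegG S′`, `a′ ∈ C_c`, one-place generators `b_w`, factor `u` with the tensor shape `hf` and the orbit invariance `hu`),
if `chartOrbGLoc L β w₀ S′ ν′_{w₀} b_{w₀} (c w₀) = 0` at some `p`-place `w₀`, then `chartOrbG ν′ S′ a′ c = 0`.
[cite: Rogawski1990, §8.2 p. 122; §8.3 p. 124] [cite: Folland1995, §2.2; §2.6 (2.52)] [cite: Shelstad1979, §4 p. 22] -/
theorem chartOrbG_eq_zero_of_tensor_of_chartOrbGLoc_eq_zero (hβ0 : ∀ i, β i ≠ 0) (hS' : ∀ w, w ∈ S' → w ∈ splitChartPlaces L β)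
    {c : {w : InfinitePlace L // IsComplex w} → Fin 3 → ℝ} (hc : c ∈ ArchCartan.RegG S')
    {a' : ↥(arch (↥(maximalRealSubfield L)) L (IsCMField.complexConj L) 3 (Matrix.diagonal β)) → ℂ} (ha'c : Continuous a') (ha's : HasCompactSupport a')
    (bw : ∀ w : {w : {w : InfinitePlace L // IsComplex w} // p w}, ↥(archLocal L 3 (Matrix.diagonal β) w.1) → ℂ)
    (u : ↥(arch (↥(maximalRealSubfield L)) L (IsCMField.complexConj L) 3 (Matrix.diagonal β)) → ℂ)
    (hf : ∀ (x : ∀ w : {w : {w : InfinitePlace L // IsComplex w} // p w}, ↥(archLocal L 3 (Matrix.diagonal β) w.1))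
      (y : ∀ w' : {w : {w : InfinitePlace L // IsComplex w} // ¬ p w}, ↥(archLocal L 3 (Matrix.diagonal β) w'.1)),
      a' ((archPiEquivCM 3 L (Matrix.diagonal β)).symm
        ((MeasurableEquiv.piEquivPiSubtypeProd (fun w : {w : InfinitePlace L // IsComplex w} => ↥(archLocal L 3 (Matrix.diagonal β) w)) p).symm (x, y))) =
      (∏ w, bw w (x w)) * u ((archPiEquivCM 3 L (Matrix.diagonal β)).symm
        ((MeasurableEquiv.piEquivPiSubtypeProd (fun w : {w : InfinitePlace L // IsComplex w} => ↥(archLocal L 3 (Matrix.diagonal β) w)) p).symm (x, y))))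
    (hu : ∀ (g : ∀ w : {w : {w : InfinitePlace L // IsComplex w} // p w}, ↥(archLocal L 3 (Matrix.diagonal β) w.1))
      (y : ∀ w' : {w : {w : InfinitePlace L // IsComplex w} // ¬ p w}, ↥(archLocal L 3 (Matrix.diagonal β) w'.1)),
      u ((archPiEquivCM 3 L (Matrix.diagonal β)).symm
        ((MeasurableEquiv.piEquivPiSubtypeProd (fun w : {w : InfinitePlace L // IsComplex w} => ↥(archLocal L 3 (Matrix.diagonal β) w)) p).symm
          (fun w => g w * gprimeBlockAt L β w.1 S' (c w.1) * (g w)⁻¹, y))) =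
      u ((archPiEquivCM 3 L (Matrix.diagonal β)).symm
        ((MeasurableEquiv.piEquivPiSubtypeProd (fun w : {w : InfinitePlace L // IsComplex w} => ↥(archLocal L 3 (Matrix.diagonal β) w)) p).symm
          (fun w => gprimeBlockAt L β w.1 S' (c w.1), y))))
    (w₀ : {w : {w : InfinitePlace L // IsComplex w} // p w}) (h0 : chartOrbGLoc L β w₀.1 S' (ν'w w₀.1) (bw w₀) (c w₀.1) = 0) :
    chartOrbG L β ν' S' a' c = 0 := by
  rw [chartOrbG_eq_prod_quotient_mul_integral_of_tensor L β S' ν'w ν' hν t p hβ0 hS' hc ha'c ha's bw u hf hu]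
  refine mul_eq_zero_of_left (Finset.prod_eq_zero (Finset.mem_univ w₀) ?_) _
  rw [boxMass_mul_integral_descConj_eq_chartOrbGLoc L β S' ν'w t w₀.1 (bw w₀) (c w₀.1)]
  exact h0

end TensorVanish

end Literature.NumberTheory.Automorphic.UnitaryGroup

namespace Literature.NumberTheory.Rogawski1990

/-! ## §1 The junk-label clause in the E3a pen's currency (★ (L1) p852251's binder `hjunk`) -/

section ClassInvariance

variable (L : Type) [Field L] [NumberField L] [IsCMField L] (β : Fin 3 → L)
  [∀ w : {w : InfinitePlace L // IsComplex w}, MeasurableSpace ↥(archLocal L 3 (Matrix.diagonal β) w)]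
  (p : {w : InfinitePlace L // IsComplex w} → Prop) [DecidablePred p]

/-- The inverse of Mathlib's `piEquivPiSubtypeProd`, read componentwise (definitional; as in ★ (J-iso)^T §2). [cite: Folland1995, §2.2] -/
private theorem piEquivPiSubtypeProd_symm_apply_dite {ι : Type*} (π : ι → Type*) [∀ i, MeasurableSpace (π i)] (q : ι → Prop)
    [DecidablePred q] (a : ∀ i : Subtype q, π i) (b : ∀ i : {i // ¬ q i}, π i) (i : ι) :
    (MeasurableEquiv.piEquivPiSubtypeProd π q).symm (a, b) i = if h : q i then a ⟨i, h⟩ else b ⟨i, h⟩ := rfl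

omit [NumberField L] [IsCMField L] [∀ w : {w : InfinitePlace L // IsComplex w}, MeasurableSpace ↥(archLocal L 3 (Matrix.diagonal β) w)] in
/-- **The place class is a class function, one place at a time**: the characteristic polynomial of the `w`-component is unchanged under conjugation in `U(β)_w`
(Mathlib `Matrix.charpoly_units_conj`). [cite: Bouaziz1994IntegralesOrbitales, §2.3 p. 578] [cite: Rogawski1990, §3.6 p. 28] -/
theorem charpoly_coe_archLocal_conj (w : {w : InfinitePlace L // IsComplex w}) (g x : ↥(archLocal L 3 (Matrix.diagonal β) w)) :
    (((g * x * g⁻¹ : ↥(archLocal L 3 (Matrix.diagonal β) w)) : GL (Fin 3) ℂ) : Matrix (Fin 3) (Fin 3) ℂ).charpoly =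
      ((x : GL (Fin 3) ℂ) : Matrix (Fin 3) (Fin 3) ℂ).charpoly := by
  simp only [Subgroup.coe_mul, Subgroup.coe_inv, Units.val_mul]
  rw [Matrix.coe_units_inv]
  exact Matrix.charpoly_units_conj _ _

/-- **The block of place classes of a point assembled from `p`-coordinates and `¬p`-coordinates does not see a conjugation of the `p`-coordinates.**
[cite: Bouaziz1994IntegralesOrbitales, §2.3 p. 578] [cite: Rogawski1990, §3.6 p. 28] -/
theorem bzClassG_symm_piEquivPiSubtypeProd_symm_conj
    (g x : ∀ w : {w : {w : InfinitePlace L // IsComplex w} // p w}, ↥(archLocal L 3 (Matrix.diagonal β) w.1))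
    (y : ∀ w' : {w : {w : InfinitePlace L // IsComplex w} // ¬ p w}, ↥(archLocal L 3 (Matrix.diagonal β) w'.1))
    (w : {w : {w : InfinitePlace L // IsComplex w} // p w}) :
    bzClassG L β ((archPiEquivCM 3 L (Matrix.diagonal β)).symm
        ((MeasurableEquiv.piEquivPiSubtypeProd (fun w : {w : InfinitePlace L // IsComplex w} => ↥(archLocal L 3 (Matrix.diagonal β) w)) p).symm
          (fun w => g w * x w * (g w)⁻¹, y))) w.1 =
      bzClassG L β ((archPiEquivCM 3 L (Matrix.diagonal β)).symm
        ((MeasurableEquiv.piEquivPiSubtypeProd (fun w : {w : InfinitePlace L // IsComplex w} => ↥(archLocal L 3 (Matrix.diagonal β) w)) p).symm (x, y))) w.1 := by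
  rw [bzClassG_apply, bzClassG_apply, ContinuousMulEquiv.apply_symm_apply, ContinuousMulEquiv.apply_symm_apply,
    piEquivPiSubtypeProd_symm_apply_dite, piEquivPiSubtypeProd_symm_apply_dite, dif_pos w.2, dif_pos w.2, charpoly_coe_archLocal_conj]

end ClassInvariance

section JunkLabel

variable (L : Type) [Field L] [NumberField L] [IsCMField L] (β : Fin 3 → L) (S' : Finset {w : InfinitePlace L // IsComplex w})
  [∀ w : {w : InfinitePlace L // IsComplex w}, MeasurableSpace ↥(archLocal L 3 (Matrix.diagonal β) w)]
  [∀ w : {w : InfinitePlace L // IsComplex w}, BorelSpace ↥(archLocal L 3 (Matrix.diagonal β) w)]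
  [∀ w : {w : InfinitePlace L // IsComplex w}, LocallyCompactSpace ↥(archLocal L 3 (Matrix.diagonal β) w)]
  [∀ w : {w : InfinitePlace L // IsComplex w}, SecondCountableTopology ↥(archLocal L 3 (Matrix.diagonal β) w)]
  [MeasurableSpace ↥(arch (↥(maximalRealSubfield L)) L (IsCMField.complexConj L) 3 (Matrix.diagonal β))]
  [BorelSpace ↥(arch (↥(maximalRealSubfield L)) L (IsCMField.complexConj L) 3 (Matrix.diagonal β))]
  [∀ w : {w : InfinitePlace L // IsComplex w}, MeasurableSpace (↥(archLocal L 3 (Matrix.diagonal β) w) ⧸ chartTorusGLoc L β w S')]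
  [∀ w : {w : InfinitePlace L // IsComplex w}, BorelSpace (↥(archLocal L 3 (Matrix.diagonal β) w) ⧸ chartTorusGLoc L β w S')]
  (ν'w : ∀ w : {w : InfinitePlace L // IsComplex w}, Measure ↥(archLocal L 3 (Matrix.diagonal β) w)) [∀ w, (ν'w w).IsHaarMeasure] [∀ w, (ν'w w).IsMulRightInvariant]
  (ν' : Measure ↥(arch (↥(maximalRealSubfield L)) L (IsCMField.complexConj L) 3 (Matrix.diagonal β))) [ν'.IsHaarMeasure] [ν'.IsMulRightInvariant]
  (hν : ν' = (Measure.pi ν'w).map (archPiEquivCM 3 L (Matrix.diagonal β)).symm)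
  (t : ∀ w : {w : InfinitePlace L // IsComplex w}, Measure ↥(chartTorusGLoc L β w S')) [∀ w, (t w).IsHaarMeasure] [∀ w, (t w).IsInvInvariant]
  (p : {w : InfinitePlace L // IsComplex w} → Prop) [DecidablePred p]
  [Fintype {w : {w : InfinitePlace L // IsComplex w} // p w}] [Fintype {w : {w : InfinitePlace L // IsComplex w} // ¬ p w}]

include hν t in
/-- **THE JUNK-LABEL CLAUSE (E3a slice (s2); ★ (L1)'s `hjunk` at one place `w₀` and one partner relabelling `ρ`).**  Frame `β`, admissible label `S′`, block `p`, `G`-regular `c`; the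
per-ball test function `f ∈ C_c(G_∞)` of the ★ §2(7) shape `hf` (one-place generators `f_w` at the `p`-places weighted by class multipliers `mcl_w ∘ cl_w`, times a coupling `G(cl_D k, k_I)`); at the
place `w₀` with `p w₀` AND `w₀ ∈ S′` (the label MEETS the block): the weight `mcl_{w₀}` lives in the `ε`-ball round `b` (`hmcl`) and the generator `f_{w₀}` obeys E1's SPLIT CLAUSE on `S′` (`hsplit`,
★ `EPGeneratorAt`).  Then `orbFamGExt L β ν′ f S′ (ρ·c) = 0` for every `ρ ∈ partnerPerms S′`.  Route: docblock (dichotomy on the frozen weight; (A) ★ (c1) orbit vanishing, (B) ★ (F2) tensor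
reading with the `w₀`-factor `chartOrbGLoc … f_{w₀} ((ρ·c) w₀) = 0`).
[cite: Rogawski1990, §4.1 (4.1.1) p. 39; §8.2 p. 122; §8.3 p. 124] [cite: Shelstad1979, §4 p. 22; Lemma 4.2 p. 23] [cite: Folland1995, §2.6 (2.52)] [cite: Bouaziz1994IntegralesOrbitales, §6.2 p. 591] -/
theorem orbFamGExt_slotPerm_eq_zero_of_tensor_of_split (hβ0 : ∀ i, β i ≠ 0) (hS' : ∀ w, w ∈ S' → w ∈ splitChartPlaces L β)
    {c : {w : InfinitePlace L // IsComplex w} → Fin 3 → ℝ} (hc : c ∈ ArchCartan.RegG S')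
    {f : ↥(arch (↥(maximalRealSubfield L)) L (IsCMField.complexConj L) 3 (Matrix.diagonal β)) → ℂ} (hfc : Continuous f) (hfs : HasCompactSupport f)
    (mcl : {w : {w : InfinitePlace L // IsComplex w} // p w} → ℂ × ℂ × ℂ → ℂ)
    (fw : ∀ w : {w : {w : InfinitePlace L // IsComplex w} // p w}, ↥(archLocal L 3 (Matrix.diagonal β) w.1) → ℂ)
    (G : ({w : {w : InfinitePlace L // IsComplex w} // p w} → ℂ × ℂ × ℂ) →
      (∀ w' : {w : {w : InfinitePlace L // IsComplex w} // ¬ p w}, ↥(archLocal L 3 (Matrix.diagonal β) w'.1)) → ℂ)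
    (hf : ∀ k, f k = (∏ w : {w : {w : InfinitePlace L // IsComplex w} // p w}, mcl w (bzClassG L β k w.1) * fw w (archPiEquivCM 3 L (Matrix.diagonal β) k w.1)) *
      G (fun w => bzClassG L β k w.1) (fun w' => archPiEquivCM 3 L (Matrix.diagonal β) k w'.1))
    (w₀ : {w : {w : InfinitePlace L // IsComplex w} // p w}) (hw₀ : w₀.1 ∈ S') (b : ℂ × ℂ × ℂ) (ε : ℝ)
    (hmcl : ∀ z, mcl w₀ z ≠ 0 → dist z b < ε)
    (hsplit : ∀ c' : {w : InfinitePlace L // IsComplex w} → Fin 3 → ℝ, w₀.1 ∈ S' → c' w₀.1 0 ≠ 0 → dist (bzClassMapG S' c' w₀.1) b < ε →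
      chartOrbGLoc L β w₀.1 S' (ν'w w₀.1) (fw w₀) (c' w₀.1) = 0)
    {ρ : {w : InfinitePlace L // IsComplex w} → Equiv.Perm (Fin 3)} (hρ : ρ ∈ partnerPerms S') :
    orbFamGExt L β ν' f S' (slotPerm ρ c) = 0 := by
  have hc' : slotPerm ρ c ∈ ArchCartan.RegG S' := (slotPerm_mem_regG_iff hρ c).2 hc
  have hne : slotPerm ρ c w₀.1 0 ≠ 0 := ((ArchCartan.mem_regG_iff S' _).1 hc').2 w₀.1 hw₀
  by_cases hA : mcl w₀ (bzClassMapG S' (slotPerm ρ c) w₀.1) = 0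
  · -- (A) the frozen weight vanishes: `f` vanishes on the class of the chart point
    refine orbFamGExt_eq_zero_of_forall_conj_of_mem_regG L β ν' S' hc' fun y => ?_
    rw [hf, bzClassG_conj, bzClassG_gprimeTorus L β S' hS']
    exact mul_eq_zero_of_left (Finset.prod_eq_zero (Finset.mem_univ w₀) (by rw [hA, zero_mul])) _
  · -- (B) the weight is read inside the `ε`-ball: the split clause kills the one-place reading of `f_{w₀}` at `(ρ·c) w₀`
    have h0 : chartOrbGLoc L β w₀.1 S' (ν'w w₀.1) (fw w₀) (slotPerm ρ c w₀.1) = 0 := hsplit _ hw₀ hne (hmcl _ hA)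
    rw [orbFamGExt_of_mem_regG_of_admissible L β ν' f S' hS' hc']
    refine mul_eq_zero_of_right _ ?_
    refine chartOrbG_eq_zero_of_tensor_of_chartOrbGLoc_eq_zero L β S' ν'w ν' hν t p hβ0 hS' hc' hfc hfs fw
      (fun k => (∏ w : {w : {w : InfinitePlace L // IsComplex w} // p w}, mcl w (bzClassG L β k w.1)) *
        G (fun w => bzClassG L β k w.1) (fun w' => archPiEquivCM 3 L (Matrix.diagonal β) k w'.1))
      (fun x y => ?_) (fun g y => ?_) w₀ h0
    · -- the tensor shape: `f = (Π f_w(x_w)) · u`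
      rw [hf, Finset.prod_mul_distrib]
      have hx : ∀ w : {w : {w : InfinitePlace L // IsComplex w} // p w},
          archPiEquivCM 3 L (Matrix.diagonal β) ((archPiEquivCM 3 L (Matrix.diagonal β)).symm
            ((MeasurableEquiv.piEquivPiSubtypeProd (fun w : {w : InfinitePlace L // IsComplex w} => ↥(archLocal L 3 (Matrix.diagonal β) w)) p).symm (x, y))) w.1 = x w := by
        intro w
        rw [ContinuousMulEquiv.apply_symm_apply, piEquivPiSubtypeProd_symm_apply_dite, dif_pos w.2]
      simp only [hx]
      ring
    · -- `u` does not see a conjugation of the `p`-coordinates (classes and the `¬p`-coordinates only)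
      have hy : ∀ (z : ∀ w : {w : {w : InfinitePlace L // IsComplex w} // p w}, ↥(archLocal L 3 (Matrix.diagonal β) w.1))
          (w' : {w : {w : InfinitePlace L // IsComplex w} // ¬ p w}),
          archPiEquivCM 3 L (Matrix.diagonal β) ((archPiEquivCM 3 L (Matrix.diagonal β)).symm
            ((MeasurableEquiv.piEquivPiSubtypeProd (fun w : {w : InfinitePlace L // IsComplex w} => ↥(archLocal L 3 (Matrix.diagonal β) w)) p).symm (z, y))) w'.1 = y w' := by
        intro z w'
        rw [ContinuousMulEquiv.apply_symm_apply, piEquivPiSubtypeProd_symm_apply_dite, dif_neg w'.2]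
      simp only [hy, bzClassG_symm_piEquivPiSubtypeProd_symm_conj L β p g]

include hν t in
/-- **THE JUNK-LABEL CLAUSE, ALL PARTNER POINTS** (★ (L1)'s `hjunk` for the label `S′`, from a WITNESS place `w₀ ∈ S′` in the block): under the hypotheses of
`orbFamGExt_slotPerm_eq_zero_of_tensor_of_split`, `∀ ρ ∈ partnerPerms S′, orbFamGExt L β ν′ f S′ (ρ·c) = 0`, hence also `stableSumG (orbFamGExt L β ν′ f) S′ c = 0`.
[cite: Rogawski1990, §4.1 (4.1.1) p. 39] [cite: Shelstad1979, Lemma 4.2 p. 23] -/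
theorem stableSumG_orbFamGExt_eq_zero_of_tensor_of_split (hβ0 : ∀ i, β i ≠ 0) (hS' : ∀ w, w ∈ S' → w ∈ splitChartPlaces L β)
    {c : {w : InfinitePlace L // IsComplex w} → Fin 3 → ℝ} (hc : c ∈ ArchCartan.RegG S')
    {f : ↥(arch (↥(maximalRealSubfield L)) L (IsCMField.complexConj L) 3 (Matrix.diagonal β)) → ℂ} (hfc : Continuous f) (hfs : HasCompactSupport f)
    (mcl : {w : {w : InfinitePlace L // IsComplex w} // p w} → ℂ × ℂ × ℂ → ℂ)
    (fw : ∀ w : {w : {w : InfinitePlace L // IsComplex w} // p w}, ↥(archLocal L 3 (Matrix.diagonal β) w.1) → ℂ)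
    (G : ({w : {w : InfinitePlace L // IsComplex w} // p w} → ℂ × ℂ × ℂ) →
      (∀ w' : {w : {w : InfinitePlace L // IsComplex w} // ¬ p w}, ↥(archLocal L 3 (Matrix.diagonal β) w'.1)) → ℂ)
    (hf : ∀ k, f k = (∏ w : {w : {w : InfinitePlace L // IsComplex w} // p w}, mcl w (bzClassG L β k w.1) * fw w (archPiEquivCM 3 L (Matrix.diagonal β) k w.1)) *
      G (fun w => bzClassG L β k w.1) (fun w' => archPiEquivCM 3 L (Matrix.diagonal β) k w'.1))
    (w₀ : {w : {w : InfinitePlace L // IsComplex w} // p w}) (hw₀ : w₀.1 ∈ S') (b : ℂ × ℂ × ℂ) (ε : ℝ)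
    (hmcl : ∀ z, mcl w₀ z ≠ 0 → dist z b < ε)
    (hsplit : ∀ c' : {w : InfinitePlace L // IsComplex w} → Fin 3 → ℝ, w₀.1 ∈ S' → c' w₀.1 0 ≠ 0 → dist (bzClassMapG S' c' w₀.1) b < ε →
      chartOrbGLoc L β w₀.1 S' (ν'w w₀.1) (fw w₀) (c' w₀.1) = 0) :
    (∀ ρ ∈ partnerPerms S', orbFamGExt L β ν' f S' (slotPerm ρ c) = 0) ∧ stableSumG (orbFamGExt L β ν' f) S' c = 0 := by
  have h : ∀ ρ ∈ partnerPerms S', orbFamGExt L β ν' f S' (slotPerm ρ c) = 0 := fun ρ hρ =>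
    orbFamGExt_slotPerm_eq_zero_of_tensor_of_split L β S' ν'w ν' hν t p hβ0 hS' hc hfc hfs mcl fw G hf w₀ hw₀ b ε hmcl hsplit hρ
  refine ⟨h, ?_⟩
  rw [stableSumG_apply]
  exact Finset.sum_eq_zero fun ρ hρ => by rw [h ρ hρ, mul_zero]

end JunkLabel

end Literature.NumberTheory.Rogawski1990

end
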